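import Summits.AtomisticToContinuum.Crystallization.Theses.GappedShellCensus
import Summits.AtomisticToContinuum.Crystallization.Theorems.CleanLimitsHaveWindows.Negative.WindowArgument
import Literature.Barriers.AtomisticToContinuum.KissingTwelveDegeneracy
import Literature.MathematicalPhysics.StatisticalMechanics.LocalMatchingCompactness

/-!
# Disproof of `CleanLimitsHaveWindows` (stmt-AtomisticToContinuum-15932) — findings

Standing disprover `refuter-cdisprove-stmt-AtomisticToContinuum-15932-0`, cycle 1 (2026-08-17).
Crux (route `GappedShellCensus`, rank 5): for every sequence `x` of LJ ground states (H1), every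
`Y ∋ 0` (H3) with scale `a ∈ [47/50, 1]` (H2) that is a local limit of translates of a subsequence
(H4) and everywhere CLEAN — gapped-twelve with `1/5`-fcc/hcp shells (H5) — the sequence `x` has
PERIODIC WINDOWS (conclusion C = `HullMinimality.PeriodicWindows` at `x`).

VERDICT SO FAR: no kill; the crux is open-problem-grade (conditional LJ crystallization). What is
decidable without a theory of true LJ ground states has been decided:

* (a) LOAD-BEARING ANALYSIS
  - H1 `IsGroundState` is LOAD-BEARING — LANDED `Negative.not_cleanLimitsHaveWindows_without_isGroundState`
    (p135586; files `Theorems/CleanLimitsHaveWindows/Negative/{RulerStackingClean p135158,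
    RulerStackingClusters p135392, WindowLemmas p135415, WindowArgument p135586}.lean`, all ACCEPTED;
    the landed theorem carries the weakened statement INLINE — a named `def … : Prop` wrapper
    (p136524) was bounced by the gate's fact-relocation rule, so the named forms live HERE:
    `WithoutIsGroundState` / `withoutIsGroundState_false`): with H1 weakened to
    injectivity the crux is FALSE. Witness: `Y = barlowStacking 1 √(2/3) r` for the 2-adic RULER
    Hägg word `r k = (−1)^{ν₂|k|}` (no `m`-periodic stretch of `4m+1` comparisons), `a = 1`,
    `x N` = `N` points of `Y` sandwiched between balls; `Y` is exactly clean (`Negative.clean`),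
    is a local limit of `x` (`φ = id`, `t = 0`), and `x` has NO periodic windows: a two-way
    `1/10`-match with a periodic `P` on a large ball forces a transverse lattice vector to be an
    almost-period of the window, i.e. the Hägg word to be `M`-periodic on `4M+1` layers.
    READING: everything the crux adds to `CleanLocalLimit` is energetic; shapes alone (H2–H5) do
    not give C. Any proof must use minimality to exclude aperiodic (ruler/Thue–Morse) stackings
    and, more generally, non-periodic clean limits — i.e. steps (b) strain exactification and (c)
    stacking selection of the card are unavoidable, (a)+(d) are not enough.
  - H3 `0 ∈ Y` only excludes the junk model `Y = ∅`: `withoutOrigin_iff_periodicWindows` — without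
    it the item IS `PeriodicWindows` (stmt-3240, the open conjecture (ii)); not refutable.
  - H4 (local limit) ties `Y` to `x`: `withoutLocalLimit_iff_periodicWindows` — dropped, the item is
    again `PeriodicWindows` (a clean `Y ∋ 0` exists: the fcc stacking, `Negative.clean`).
  - H5 (cleanness): `withoutClean_iff_periodicWindows` — dropped, the item IS `PeriodicWindows`
    (every ground-state sequence has a local limit `Y ∋ 0`: `exists_isSubseqLimit`, from the tree's
    `exists_subseq_forall_eventually_ballMatch` and the proved `1/3`-separation
    `LennardJonesMinimalDistance_holds`). So EACH of H3, H4, H5 alone carries the whole distance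
    between the crux and the open conjecture 3240; only their conjunction narrows the class.
  - H2 (`47/50 ≤ a ≤ 1`) is scale bookkeeping; irrelevant to truth.
  - Sandwich (refuter-rattack, evidence W.lean, re-proved below): `PeriodicWindows → crux` and
    `CleanLocalLimit → (crux → PeriodicWindows)`: modulo the route's target the crux ≡ 3240.
* (b) TIGHTNESS: the conclusion has no constant to saturate; the tolerances `1/50, 63/50, 1/5`
  only widen the hypothesis class. Exact (tolerance-0) clean sets already defeat the energy-free
  reading, so no tolerance bookkeeping can rescue it.
* (c) NATURAL STRENGTHENINGS refuted: (c1) "an everywhere-clean `Y` is the point set of a periodic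
  configuration" — FALSE (`not_clean_imp_periodic`: fcc with one twin, tree
  `not_exists_periodicConfiguration_spike`); (c2) "clean + local limit of injective configurations ⇒
  periodic windows" — FALSE (H1 analysis above); (c3) "`∀ᶠ N` instead of `∃ᶠ N` in C", "P may be
  taken fcc/hcp" — undecidable without ground-state theory (would need two GS subsequences with
  different clean limits); no attack.
* (d) TARGETS (lead's stuck stubs): none received yet (`stuck_stubs = []`; line `Sketch` picked:
  `CleanHullRecurrent` soft, `TransversalClosing` hard). Remark for `TransversalClosing`: its
  conclusion `Z = v + layeredSet A a' s z` for a uniformly recurrent clean hull element is NOT hit by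
  the ruler witness (the ruler stacking IS exactly layered — `layeredSet` with the ruler word and
  equal heights — so it satisfies the stub's conclusion; the stub asks for exact layering, not
  periodicity); periodicity is produced afterwards by the PROVED `PeriodicGivenLayered` from the
  ENERGY of layered hull elements (`InHull x`). So the line routes the load through energy exactly
  where this file says it must go; an energy-free proof of `TransversalClosing` is not excluded by
  anything here, but its hypothesis `InHull x Z` is where minimality must enter.
* (e) NEAR-MISSES: none open.
-/

noncomputable section

namespace Summit.AtomisticToContinuum.Crystallization.Cruxes.CleanLimitsHaveWindows.Disproof

open Literature.MathematicalPhysics.StatisticalMechanics Literature.Geometry.DiscreteGeometry Filter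
open Summit.AtomisticToContinuum.Crystallization.Theses.GappedShellCensus
open Summit.AtomisticToContinuum.Crystallization.Theorems.CleanLimitsHaveWindows.Negative

/-! ## (a) Load-bearing analysis -/

/-! ### H1 `IsGroundState`: see `Negative.cleanLimitsHaveWindows_false_without_isGroundState`
(file `Theorems/CleanLimitsHaveWindows/Negative/FalseWithoutGroundState.lean`; imported here once
landed). The weakened statement implies the crux: -/

/-- The crux's local-limit clause (H4), as a predicate. [folklore] -/
def IsSubseqLimit (x : (N : ℕ) → (Fin N → EuclideanSpace ℝ (Fin 3)))
    (Y : Set (EuclideanSpace ℝ (Fin 3))) : Prop :=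
  ∃ (φ : ℕ → ℕ) (t : ℕ → EuclideanSpace ℝ (Fin 3)), StrictMono φ ∧ ∀ R ε : ℝ, 0 < ε →
    ∀ᶠ n in Filter.atTop,
      (∀ y ∈ Y, ‖y‖ ≤ R → ∃ i : Fin (φ n), dist (x (φ n) i + t n) y ≤ ε) ∧
      (∀ i : Fin (φ n), ‖x (φ n) i + t n‖ ≤ R → ∃ y ∈ Y, dist (x (φ n) i + t n) y ≤ ε)

/-- The crux's cleanness clause (H5), as a predicate. [folklore] -/
def IsClean (a : ℝ) (Y : Set (EuclideanSpace ℝ (Fin 3))) : Prop :=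
  ∀ y ∈ Y, ({w ∈ Y | w ≠ y ∧ dist y w ≤ a * (1 + 1 / 50)}.ncard = 12 ∧
      ∀ w ∈ Y, w ≠ y → a * (1 - 1 / 50) ≤ dist y w ∧
        (dist y w ≤ a * (1 + 1 / 50) ∨ a * (63 / 50) ≤ dist y w)) ∧
    ∃ T : Finset (EuclideanSpace ℝ (Fin 3)),
      (↑T : Set (EuclideanSpace ℝ (Fin 3))) =
          (fun w => a⁻¹ • (w - y)) '' {w ∈ Y | w ≠ y ∧ dist y w ≤ a * (1 + 1 / 50)} ∧
        (ShellCloseTo (1 / 5) T fccKissingPattern ∨ ShellCloseTo (1 / 5) T hcpKissingPattern)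

/-- The crux's conclusion (C) at `x`: periodic windows (verbatim the body of
`HullMinimality.PeriodicWindows`). [folklore] -/
def HasPeriodicWindows (x : (N : ℕ) → (Fin N → EuclideanSpace ℝ (Fin 3))) : Prop :=
  ∃ P : PeriodicConfiguration 3, ∀ R ε : ℝ, 0 < ε → ∃ᶠ N in Filter.atTop,
    ∃ t : EuclideanSpace ℝ (Fin 3),
      (∀ s ∈ P.points, ‖s‖ ≤ R → ∃ i : Fin N, dist (x N i + t) s ≤ ε) ∧
      (∀ i : Fin N, ‖x N i + t‖ ≤ R → ∃ s ∈ P.points, dist (x N i + t) s ≤ ε)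

/-- The crux, refolded through the three predicates (definitional). [folklore] -/
theorem cleanLimitsHaveWindows_iff :
    CleanLimitsHaveWindows ↔
      ∀ x : (N : ℕ) → (Fin N → EuclideanSpace ℝ (Fin 3)),
        (∀ N, IsGroundState lennardJones (x N)) →
        ∀ (Y : Set (EuclideanSpace ℝ (Fin 3))) (a : ℝ), 47 / 50 ≤ a → a ≤ 1 →
          (0 : EuclideanSpace ℝ (Fin 3)) ∈ Y → IsSubseqLimit x Y → IsClean a Y →
          HasPeriodicWindows x :=
  Iff.rfl

/-- **H1 weakened to injectivity** (the statement refuted, inline, by the landed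
`Negative.not_cleanLimitsHaveWindows_without_isGroundState`, `Negative/WindowArgument.lean`). [folklore] -/
def WithoutIsGroundState : Prop :=
  ∀ x : (N : ℕ) → (Fin N → EuclideanSpace ℝ (Fin 3)), (∀ N, Function.Injective (x N)) →
    ∀ (Y : Set (EuclideanSpace ℝ (Fin 3))) (a : ℝ), 47 / 50 ≤ a → a ≤ 1 →
      (0 : EuclideanSpace ℝ (Fin 3)) ∈ Y → IsSubseqLimit x Y → IsClean a Y → HasPeriodicWindows x

/-- The weakening is one: ground states are injective, so `WithoutIsGroundState → crux`.
[folklore] -/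
theorem cleanLimitsHaveWindows_of_withoutIsGroundState (h : WithoutIsGroundState) :
    CleanLimitsHaveWindows :=
  fun x hx => h x fun N => (hx N).1

/-- **H1 is load-bearing: `WithoutIsGroundState` is FALSE** — the landed negative lemma
`Negative.not_cleanLimitsHaveWindows_without_isGroundState` (p135586; witness: the 2-adic ruler
stacking, an everywhere-clean local limit of its own cluster sequence without periodic windows).
[folklore] -/
theorem withoutIsGroundState_false : ¬ WithoutIsGroundState :=
  not_cleanLimitsHaveWindows_without_isGroundState

/-! ### H3 `0 ∈ Y` and H4 (local limit): dropped, the item collapses to `PeriodicWindows` -/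

/-- The crux without `0 ∈ Y`. [folklore] -/
def WithoutOrigin : Prop :=
  ∀ x : (N : ℕ) → (Fin N → EuclideanSpace ℝ (Fin 3)),
    (∀ N, IsGroundState lennardJones (x N)) →
    ∀ (Y : Set (EuclideanSpace ℝ (Fin 3))) (a : ℝ), 47 / 50 ≤ a → a ≤ 1 →
      IsSubseqLimit x Y → IsClean a Y → HasPeriodicWindows x

/-- The crux without the local-limit clause. [folklore] -/
def WithoutLocalLimit : Prop :=
  ∀ x : (N : ℕ) → (Fin N → EuclideanSpace ℝ (Fin 3)),
    (∀ N, IsGroundState lennardJones (x N)) →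
    ∀ (Y : Set (EuclideanSpace ℝ (Fin 3))) (a : ℝ), 47 / 50 ≤ a → a ≤ 1 →
      (0 : EuclideanSpace ℝ (Fin 3)) ∈ Y → IsClean a Y → HasPeriodicWindows x

/-- The empty set is a "local limit" of every sequence (translate to infinity): the junk model
that `0 ∈ Y` excludes. [folklore] -/
theorem isSubseqLimit_empty (x : (N : ℕ) → (Fin N → EuclideanSpace ℝ (Fin 3))) :
    IsSubseqLimit x ∅ := by
  set u : EuclideanSpace ℝ (Fin 3) := barlowPos 1 (Real.sqrt (2 / 3)) constHagg 0 1 0 with hu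
  have hun : ‖u‖ = 1 := by
    rw [hu, EuclideanSpace.norm_eq, Fin.sum_univ_three]; simp
  refine ⟨id, fun n => ((∑ i, ‖x n i‖) + n) • u, strictMono_id, fun R ε _ => ?_⟩
  filter_upwards [eventually_gt_atTop ⌈R⌉₊] with n hn
  refine ⟨fun y hy => hy.elim, fun i hi => ?_⟩
  exfalso
  have hR : R ≤ ⌈R⌉₊ := Nat.le_ceil R
  have hn' : (⌈R⌉₊ : ℝ) < n := by exact_mod_cast hn
  have hsum : ‖x n i‖ ≤ ∑ j, ‖x n j‖ :=
    Finset.single_le_sum (f := fun j => ‖x n j‖) (fun j _ => norm_nonneg (x n j))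
      (Finset.mem_univ i)
  have hS : 0 ≤ (∑ j, ‖x n j‖) + (n : ℝ) :=
    add_nonneg (Finset.sum_nonneg fun j _ => norm_nonneg (x n j)) (Nat.cast_nonneg n)
  have ht : ‖((∑ j, ‖x n j‖) + (n : ℝ)) • u‖ = (∑ j, ‖x n j‖) + n := by
    rw [norm_smul, Real.norm_eq_abs, abs_of_nonneg hS, hun, mul_one]
  have h2 : ‖((∑ j, ‖x n j‖) + (n : ℝ)) • u‖ ≤
      ‖x n i + ((∑ j, ‖x n j‖) + (n : ℝ)) • u‖ + ‖x n i‖ := by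
    have := norm_sub_le (x n i + ((∑ j, ‖x n j‖) + (n : ℝ)) • u) (x n i)
    rwa [add_sub_cancel_left] at this
  have hi' : ‖x n i + ((∑ j, ‖x n j‖) + (n : ℝ)) • u‖ ≤ R := hi
  linarith

/-- **Without `0 ∈ Y` the crux IS `PeriodicWindows`** (stmt-3240): `Y = ∅` is vacuously clean and
a local limit of everything. [folklore] -/
theorem withoutOrigin_iff_periodicWindows :
    WithoutOrigin ↔ Summit.AtomisticToContinuum.Crystallization.Theses.HullMinimality.PeriodicWindows := by
  constructor
  · intro h x hx
    exact h x hx ∅ 1 (by norm_num) le_rfl (isSubseqLimit_empty x)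
      (fun y hy => hy.elim)
  · intro h x hx _ _ _ _ _ _
    exact h x hx

/-- **Without the local-limit clause the crux IS `PeriodicWindows`**: a clean `Y ∋ 0` unrelated to
`x` exists — any unit ideal Barlow stacking (`Negative.clean`, here fcc). [folklore] -/
theorem withoutLocalLimit_iff_periodicWindows :
    WithoutLocalLimit ↔ Summit.AtomisticToContinuum.Crystallization.Theses.HullMinimality.PeriodicWindows := by
  constructor
  · intro h x hx
    refine h x hx (barlowStacking 1 (Real.sqrt (2 / 3)) constHagg) 1 (by norm_num) le_rfl
      ⟨0, 0, 0, by simp [barlowPos]⟩ (clean isHaggSeq_const)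
  · intro h x hx _ _ _ _ _ _
    exact h x hx


/-! ### H5 (cleanness): dropped, the item is again exactly `PeriodicWindows` -/

/-- The crux without the cleanness clause. [folklore] -/
def WithoutClean : Prop :=
  ∀ x : (N : ℕ) → (Fin N → EuclideanSpace ℝ (Fin 3)),
    (∀ N, IsGroundState lennardJones (x N)) →
    ∀ (Y : Set (EuclideanSpace ℝ (Fin 3))) (a : ℝ), 47 / 50 ≤ a → a ≤ 1 →
      (0 : EuclideanSpace ℝ (Fin 3)) ∈ Y → IsSubseqLimit x Y → HasPeriodicWindows x

/-- **Every sequence of LJ ground states has a local limit containing the origin** in the crux's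
two-way form: translate particle `0` of `x (k+1)` to the origin and extract with the tree's
`exists_subseq_forall_eventually_ballMatch`, using the proved uniform `1/3`-separation of LJ
ground states (`LennardJonesMinimalDistance_holds`); the origin survives in the limit because the
limit is separated. [folklore] -/
theorem exists_isSubseqLimit (x : (N : ℕ) → (Fin N → EuclideanSpace ℝ (Fin 3)))
    (hx : ∀ N, IsGroundState lennardJones (x N)) :
    ∃ Y : Set (EuclideanSpace ℝ (Fin 3)), (0 : EuclideanSpace ℝ (Fin 3)) ∈ Y ∧ IsSubseqLimit x Y := by
  obtain ⟨δ, hδ, hsepGS⟩ := LennardJonesMinimalDistance_holds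
  set c : ℕ → EuclideanSpace ℝ (Fin 3) := fun k => x (k + 1) ⟨0, Nat.succ_pos k⟩ with hc
  set Ys : ℕ → Set (EuclideanSpace ℝ (Fin 3)) :=
    fun k => Set.range fun i : Fin (k + 1) => x (k + 1) i - c k with hYs
  have hsep : ∀ k, ∀ p ∈ Ys k, ∀ q ∈ Ys k, p ≠ q → δ ≤ dist p q := by
    rintro k p ⟨i, rfl⟩ q ⟨j, rfl⟩ hpq
    have hij : i ≠ j := fun h => hpq (by simp [h])
    have e : dist (x (k + 1) i - c k) (x (k + 1) j - c k) = dist (x (k + 1) i) (x (k + 1) j) := by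
      rw [dist_eq_norm, dist_eq_norm]; congr 1; abel
    rw [e]
    exact hsepGS (k + 1) (x (k + 1)) (hx (k + 1)) i j hij
  obtain ⟨φ, Y, hφ, hYsep, hmatch⟩ := exists_subseq_forall_eventually_ballMatch hδ Ys hsep
  have h0Ys : ∀ k, (0 : EuclideanSpace ℝ (Fin 3)) ∈ Ys k := fun k => ⟨⟨0, Nat.succ_pos k⟩, sub_self _⟩
  have hnear : ∀ ε : ℝ, 0 < ε → ∃ s ∈ Y, dist (0 : EuclideanSpace ℝ (Fin 3)) s ≤ ε := by
    intro ε hε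
    obtain ⟨k, hk⟩ := (hmatch 0 ε hε).exists
    exact hk.2 0 (h0Ys (φ k)) (by simp)
  have h0 : (0 : EuclideanSpace ℝ (Fin 3)) ∈ Y := by
    obtain ⟨s, hs, hs1⟩ := hnear (δ / 3) (by positivity)
    suffices hs0 : s = 0 by rwa [hs0] at hs
    by_contra hne
    have hpos : 0 < dist (0 : EuclideanSpace ℝ (Fin 3)) s := dist_pos.2 (Ne.symm hne)
    obtain ⟨s', hs', hs'1⟩ := hnear (min (δ / 3) (dist (0 : EuclideanSpace ℝ (Fin 3)) s / 2))
      (lt_min (by positivity) (by positivity))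
    have hmin1 := min_le_left (δ / 3) (dist (0 : EuclideanSpace ℝ (Fin 3)) s / 2)
    have hmin2 := min_le_right (δ / 3) (dist (0 : EuclideanSpace ℝ (Fin 3)) s / 2)
    have hss' : s' = s := by
      by_contra hne'
      have h1 := hYsep s' hs' s hs hne'
      have h2 : dist s' s ≤ dist s' 0 + dist 0 s := dist_triangle _ _ _
      rw [dist_comm s' 0] at h2
      linarith
    rw [hss'] at hs'1
    linarith
  refine ⟨Y, h0, fun k => φ k + 1, fun k => -c (φ k), fun a b hab => by simpa using hφ hab,
    fun R ε hε => ?_⟩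
  filter_upwards [hmatch R ε hε] with k hk
  constructor
  · intro y hy hyR
    obtain ⟨a, ⟨i, rfl⟩, hai⟩ := hk.1 y hy (by simpa using hyR)
    exact ⟨i, by rw [← sub_eq_add_neg]; exact hai⟩
  · intro i hi
    obtain ⟨s, hs, hsi⟩ := hk.2 (x (φ k + 1) i - c (φ k)) ⟨i, rfl⟩
      (by simpa [sub_eq_add_neg] using hi)
    exact ⟨s, hs, by rw [← sub_eq_add_neg]; exact hsi⟩

/-- **Without the cleanness clause the crux IS `PeriodicWindows`** (stmt-3240). [folklore] -/
theorem withoutClean_iff_periodicWindows :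
    WithoutClean ↔ Summit.AtomisticToContinuum.Crystallization.Theses.HullMinimality.PeriodicWindows := by
  constructor
  · intro h x hx
    obtain ⟨Y, h0, hlim⟩ := exists_isSubseqLimit x hx
    exact h x hx Y 1 (by norm_num) le_rfl h0 hlim
  · intro h x hx _ _ _ _ _ _
    exact h x hx

/-! ### The sandwich (refuter-rattack's W.lean, re-proved): modulo the route target the crux ≡ 3240 -/

/-- `PeriodicWindows → crux` (the conclusion does not mention `Y`). [folklore] -/
theorem cleanLimitsHaveWindows_of_periodicWindows
    (h : Summit.AtomisticToContinuum.Crystallization.Theses.HullMinimality.PeriodicWindows) :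
    CleanLimitsHaveWindows :=
  fun x hx _ _ _ _ _ _ _ => h x hx

/-- `CleanLocalLimit → crux → PeriodicWindows` (this is step (2) of the route's `closes`). [folklore] -/
theorem periodicWindows_of_cleanLocalLimit (hCL : CleanLocalLimit) (h : CleanLimitsHaveWindows) :
    Summit.AtomisticToContinuum.Crystallization.Theses.HullMinimality.PeriodicWindows := by
  intro x hx
  obtain ⟨Y, a, ha1, ha2, h0, hlim, hclean⟩ := hCL x hx
  exact h x hx Y a ha1 ha2 h0 hlim hclean

/-! ## (c) Natural strengthenings, refuted -/

/-- **(c1) Clean does not imply periodic.** It is FALSE that every non-empty everywhere-clean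
configuration is the point set of a periodic configuration: the fcc stacking with a single twin
plane (`spikeHagg`) is exactly clean (`Negative.clean`) and has no period (tree
`not_exists_periodicConfiguration_spike`). So even for EXACT clean limits, periodicity of `Y`
itself is not available — the conclusion can only be periodic WINDOWS of `x`, obtained elsewhere in
the hull (the card's "some translate-limit of `Y`"). [folklore] -/
theorem not_clean_imp_periodic :
    ¬ ∀ (Y : Set (EuclideanSpace ℝ (Fin 3))) (a : ℝ), 0 < a → Y.Nonempty → IsClean a Y →
        ∃ P : PeriodicConfiguration 3, P.points = Y := by
  intro h
  have hsq : Real.sqrt (2 / 3) ≠ 0 := Real.sqrt_ne_zero'.2 (by norm_num)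
  exact Literature.Barriers.AtomisticToContinuum.not_exists_periodicConfiguration_spike one_ne_zero hsq
    (h _ 1 one_pos ⟨_, barlowPos_mem 0 0 0⟩
      (clean Literature.Barriers.AtomisticToContinuum.isHaggSeq_spike))

/-! ## (c2) = (a)/H1: clean + local limit of injective configurations ⇏ periodic windows
(`Negative.cleanLimitsHaveWindows_false_without_isGroundState`). -/

end Summit.AtomisticToContinuum.Crystallization.Cruxes.CleanLimitsHaveWindows.Disproof

end
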